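import Summits.AtomisticToContinuum.Crystallization.Theorems.PalmUnimodularRigidityBenjaminiSchrammLimit
import Summits.AtomisticToContinuum.Crystallization.Theorems.SlackRigidity.Negative.WitnessBasics
import Mathlib.MeasureTheory.Measure.Prokhorov
import Mathlib.MeasureTheory.Measure.Portmanteau
import Mathlib.MeasureTheory.Measure.LevyProkhorovMetric
import Mathlib.Probability.Kernel.Composition.MeasureCompProd
import HarnessLib

/-!
# Crux `SlackRigidity` (stmt-AtomisticToContinuum-11960), line `ekeland-surgery-parity`:
# the Benjamini–Schramm limit of a separated family

**The Benjamini–Schramm (local weak) limit along an arbitrary `δ`-separated family** of nonempty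
finite configurations `x k : Fin (n k) → ℝ³` (varying particle numbers `n k ≥ 1`, no ground-state
hypothesis): there are a subsequence `φ` and a probability law `P` on `Measure ℝ³` which is a.s. a
rooted `δ`-separated counting measure, is point-stationary (Mecke / mass-transport identity), has mean
root energy `lim_j 𝓔(x (φ j)) / n (φ j)`, and receives the uniformly re-rooted `x (φ j)` in the
density-transfer (portmanteau) form.

This is the landed `BenjaminiSchrammLimit.exists_limit` (item stmt-AtomisticToContinuum-9230, route
`PalmUnimodularRigidity`) with the uniformly rooted empirical laws `emp[n k, x k, _]` in place of
`emp[N + 1, x (N + 1), _]`: that proof uses its ground-state hypothesis only through injectivity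
(implied by separation) and to rewrite `interactionEnergy = groundStateEnergy` in the energy clause.
All the ingredients (`isProbabilityMeasure_emp`, `map_reroot_compProd_emp`, `integral_rootEnergy_emp`,
`map_reroot_compProd_eq_of_tendsto`, `isPointStationaryLaw_map_toMeasure`,
`continuous_integral_lennardJones_toMeasure`, `measurableEmbedding_toMeasure`, …) are the landed
helper lemmas of that file and its companions `…Campbell`, `…Energy`, `…Embedding`, `…Continuity`.
-/

noncomputable section

namespace Summit.AtomisticToContinuum.Crystallization.Theorems.EkelandSurgeryParityBSLimit

open Summit.AtomisticToContinuum.Crystallization.Theorems.SlackRigidityNegative (E3)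
open MeasureTheory Set Filter Metric TopologicalSpace ProbabilityTheory
open scoped Topology ENNReal NNReal Classical BoundedContinuousFunction
open Literature.Probability.Process Literature.Probability.Process.LocalConfig
open Literature.MathematicalPhysics.StatisticalMechanics
open Summit.AtomisticToContinuum.Crystallization.Theorems.BenjaminiSchrammLimit

variable {δ : ℝ}

set_option quotPrecheck false in
/-- The re-rooting involution `Θ (S, y) = (S - y, -y)` of the Campbell measure. -/
local notation "Θ" => fun p : RootedHardCoreConfig E3 δ × E3 =>
  ((if h : p.2 ∈ ((p.1.1 : LocalConfig E3) : Set E3) then p.1.reroot p.2 h else p.1 :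
    RootedHardCoreConfig E3 δ), -p.2)

set_option quotPrecheck false in
/-- The counting-measure kernel `S ↦ count|S`. -/
local notation "κ₀" => (⟨fun S : RootedHardCoreConfig E3 δ => (S.1 : LocalConfig E3).toMeasure,
  measurable_toMeasure (Fact.out : 0 < δ)⟩ : Kernel (RootedHardCoreConfig E3 δ) E3)

set_option quotPrecheck false in
/-- The uniformly rooted empirical law `(1/N) ∑ᵢ δ_{x seen from xᵢ}` of a finite configuration on
the space of rooted `δ`-hard-core configurations. -/
local notation "emp[" N ", " x ", " hsep "]" =>
  (((N : ℕ) : ℝ≥0∞)⁻¹ • ∑ i : Fin N, (Measure.dirac (RootedHardCoreConfig.ofFinite x hsep i) :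
    Measure (RootedHardCoreConfig E3 δ)))

/-- **The Benjamini–Schramm limit along a `δ`-separated family** (`δ > 0` fixed, nonempty
configurations `x k : Fin (n k) → ℝ³`): the uniformly rooted empirical laws on the compact metric
space of rooted `δ`-hard-core configurations have a weakly convergent subsequence (Prokhorov); exact
finite mass transport passes to the limit (`map_reroot_compProd_eq_of_tendsto`,
`isPointStationaryLaw_map_toMeasure`); the root energy is a continuous local functional
(`continuous_integral_lennardJones_toMeasure`) and `E_{P_k}[h] = 𝓔(x k) / n k` exactly
(`integral_rootEnergy_emp`); open matching events pass to the limit by the portmanteau theorem; the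
limit law is pushed to `Measure (Measure ℝ³)` along the measurable embedding `S ↦ count|S`.
This is `BenjaminiSchrammLimit.exists_limit` with the ground-state hypothesis replaced by what its
proof uses (distinct points, implied by separation). [folklore] -/
theorem exists_limit_separated [Fact (0 < δ)] {n : ℕ → ℕ} [∀ k, NeZero (n k)]
    (x : (k : ℕ) → (Fin (n k) → E3))
    (hsepx : ∀ (k : ℕ) (i j : Fin (n k)), i ≠ j → δ ≤ dist (x k i) (x k j)) :
    ∃ φ : ℕ → ℕ, StrictMono φ ∧ ∃ P : Measure (Measure E3), IsProbabilityMeasure P ∧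
      (∀ᵐ μ ∂P, (∃ S : Set E3, (0 : E3) ∈ S ∧ (∀ p ∈ S, ∀ q ∈ S, p ≠ q → δ ≤ dist p q) ∧
        μ = (Measure.count : Measure E3).restrict S)) ∧
      (∀ g : Measure E3 → E3 → ℝ≥0∞, Measurable (Function.uncurry g) →
        ∫⁻ μ, ∫⁻ y, g μ y ∂μ ∂P = ∫⁻ μ, ∫⁻ y, g (Measure.map (fun z => z - y) μ) (-y) ∂μ ∂P) ∧
      Tendsto (fun j : ℕ => interactionEnergy lennardJones (x (φ j)) / (n (φ j) : ℝ)) atTop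
        (𝓝 (∫ μ, (∫ y, lennardJones ‖y‖ ∂μ) / 2 ∂P)) ∧
      ∀ T : Set (Measure E3), ∀ R ε : ℝ, 0 < ε → ∀ ρ : ℝ, ρ < (P T).toReal →
        ∀ᶠ j : ℕ in atTop, ρ * (n (φ j) : ℝ) ≤ (Nat.card {i : Fin (n (φ j)) // ∃ ν ∈ T,
          ((∀ p : E3, ν {p} ≠ 0 → ‖p‖ ≤ R →
              ∃ q ∈ (Set.range (fun k : Fin (n (φ j)) => x (φ j) k - x (φ j) i)), dist q p ≤ ε) ∧
            (∀ q ∈ (Set.range (fun k : Fin (n (φ j)) => x (φ j) k - x (φ j) i)), ‖q‖ ≤ R →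
              ∃ p : E3, ν {p} ≠ 0 ∧ dist q p ≤ ε))} : ℝ) := by
  have hδ : 0 < δ := Fact.out
  -- distinct points, from separation
  have hinj : ∀ k, Function.Injective (x k) := fun k i j hij => by
    by_contra hne
    have h := hsepx k i j hne
    rw [hij, dist_self] at h
    exact absurd h (not_le.2 hδ)
  -- the empirical rooted laws on the compact metric space of rooted `δ`-hard-core configurations
  have hprob : ∀ k : ℕ, IsProbabilityMeasure emp[n k, x k, hsepx k] := fun k =>
    isProbabilityMeasure_emp
  set Qs : ℕ → ProbabilityMeasure (RootedHardCoreConfig E3 δ) := fun k =>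
    ⟨emp[n k, x k, hsepx k], hprob k⟩ with hQs_def
  -- Prokhorov: a weakly convergent subsequence
  obtain ⟨Q, ψ, hψ, hlim⟩ := CompactSpace.tendsto_subseq Qs
  set e : RootedHardCoreConfig E3 δ → Measure E3 := fun S => (S.1 : LocalConfig E3).toMeasure
    with he_def
  have hE : MeasurableEmbedding e := measurableEmbedding_toMeasure E3
  haveI := isSFiniteKernel_toMeasure (E := E3) (δ := δ)
  have hinvN : ∀ m, ((Qs (ψ m) : Measure (RootedHardCoreConfig E3 δ)) ⊗ₘ κ₀).map Θ =
      (Qs (ψ m) : Measure (RootedHardCoreConfig E3 δ)) ⊗ₘ κ₀ := fun m =>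
    map_reroot_compProd_emp (hinj _)
  have hinv := map_reroot_compProd_eq_of_tendsto hlim hinvN
  refine ⟨ψ, hψ,
    (Q : Measure (RootedHardCoreConfig E3 δ)).map e, Measure.isProbabilityMeasure_map hE.measurable.aemeasurable,
    ?_, ?_, ?_, ?_⟩
  · -- almost surely a rooted `δ`-hard-core counting measure
    exact (hE.ae_map_iff).2 (Eventually.of_forall fun S =>
      (isRootedHardCore_toMeasure_iff δ S.1).2 S.2)
  · -- point-stationarity
    exact isPointStationaryLaw_map_toMeasure hinv
  · -- the mean root energy
    rw [hE.integral_map]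
    set H : RootedHardCoreConfig E3 δ →ᵇ ℝ := BoundedContinuousFunction.mkOfCompact
      ⟨fun S => (∫ y, lennardJones ‖y‖ ∂((S.1 : LocalConfig E3).toMeasure)) / 2,
        (continuous_integral_lennardJones_toMeasure hδ).div_const 2⟩ with hH_def
    have hlimH := (ProbabilityMeasure.tendsto_iff_forall_integral_tendsto.1 hlim) H
    refine (hlimH.congr fun j => ?_)
    change ∫ S, (∫ y, lennardJones ‖y‖ ∂((S.1 : LocalConfig E3).toMeasure)) / 2
      ∂emp[n (ψ j), x (ψ j), hsepx (ψ j)] = _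
    rw [integral_rootEnergy_emp (hinj _)]
  · -- density transfer (portmanteau with open fattenings)
    intro T R ε hε ρ hρ
    by_cases hρ0 : ρ < 0
    · exact Eventually.of_forall fun j =>
        (mul_nonpos_of_nonpos_of_nonneg hρ0.le (Nat.cast_nonneg _)).trans (Nat.cast_nonneg _)
    rw [not_lt] at hρ0
    -- the open fattening `O` of `e ⁻¹' T`
    set O : Set (RootedHardCoreConfig E3 δ) := {S | ∃ S₀ : RootedHardCoreConfig E3 δ, e S₀ ∈ T ∧
      ∃ R' ε', R < R' ∧ 0 ≤ ε' ∧ ε' < ε ∧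
        LocallyMatches R' ε' ((S₀.1 : LocalConfig E3) : Set E3) ((S.1 : LocalConfig E3) : Set E3)}
      with hO_def
    have hO : IsOpen O := by
      have : O = ⋃ S₀ ∈ {S₀ : RootedHardCoreConfig E3 δ | e S₀ ∈ T},
          Subtype.val ⁻¹' {S : LocalConfig E3 | ∃ R' ε', R < R' ∧ 0 ≤ ε' ∧ ε' < ε ∧
            LocallyMatches R' ε' ((S₀.1 : LocalConfig E3) : Set E3) (S : Set E3)} := by
        ext S
        simp only [hO_def, mem_setOf_eq, mem_iUnion, mem_preimage, exists_prop]
      rw [this]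
      exact isOpen_biUnion fun S₀ _ =>
        (isOpen_setOf_locallyMatches _ R ε).preimage continuous_subtype_val
    have hTO : e ⁻¹' T ⊆ O := fun S hS =>
      ⟨S, hS, R + 1, ε / 2, by linarith, by linarith, by linarith, locallyMatches_self (by linarith) _ _⟩
    -- portmanteau
    have hPT : ((Q : Measure (RootedHardCoreConfig E3 δ)).map e) T ≤
        (Q : Measure (RootedHardCoreConfig E3 δ)) O := by
      rw [hE.map_apply]
      exact measure_mono hTO
    have hρO : ENNReal.ofReal ρ < (Q : Measure (RootedHardCoreConfig E3 δ)) O := by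
      rw [ENNReal.ofReal_lt_iff_lt_toReal hρ0 (measure_ne_top _ _)]
      exact hρ.trans_le (ENNReal.toReal_mono (measure_ne_top _ _) hPT)
    have hliminf := ProbabilityMeasure.le_liminf_measure_open_of_tendsto hlim hO
    have hev : ∀ᶠ j in atTop, ENNReal.ofReal ρ <
        (Qs (ψ j) : Measure (RootedHardCoreConfig E3 δ)) O :=
      eventually_lt_of_lt_liminf (hρO.trans_le hliminf)
    filter_upwards [hev] with j hj
    -- counting
    change ENNReal.ofReal ρ < emp[n (ψ j), x (ψ j), hsepx (ψ j)] O at hj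
    rw [emp_apply hO.measurableSet, ENNReal.ofReal_lt_iff_lt_toReal hρ0
      (ENNReal.mul_ne_top (ENNReal.inv_ne_top.2 (Nat.cast_ne_zero.2 (NeZero.ne (n (ψ j)))))
        (ENNReal.natCast_ne_top _)),
      ENNReal.toReal_mul, ENNReal.toReal_inv, ENNReal.toReal_natCast, ENNReal.toReal_natCast,
      inv_mul_eq_div,
      lt_div_iff₀ (Nat.cast_pos.2 (Nat.pos_of_ne_zero (NeZero.ne (n (ψ j)))))] at hj
    refine hj.le.trans ?_
    have hsub : ∀ i : Fin (n (ψ j)), RootedHardCoreConfig.ofFinite (x (ψ j)) (hsepx (ψ j)) i ∈ O →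
        ∃ ν ∈ T, LocallyMatches R ε (Set.range fun k : Fin (n (ψ j)) => x (ψ j) k - x (ψ j) i)
          (atoms ν) := by
      rintro i ⟨S₀, hS₀T, R', ε', hR', -, hε', hm⟩
      refine ⟨e S₀, hS₀T, ?_⟩
      rw [he_def]
      dsimp only
      rw [atoms_toMeasure]
      exact hm.symm.mono hR'.le hε'.le
    rw [Nat.card_eq_fintype_card, Fintype.card_subtype]
    exact_mod_cast Finset.card_le_card (Finset.monotone_filter_right _ fun i _ hi => hsub i hi)

/-- **The Benjamini–Schramm limit of a separated family.** For `δ > 0` and any family of nonempty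
`δ`-separated finite configurations `x k : Fin (n k) → ℝ³` there are a subsequence `φ` and a
probability law `P` on `Measure ℝ³` which is a.s. a rooted `δ`-separated counting measure, is
point-stationary (Mecke identity), has mean root energy `lim_j 𝓔(x (φ j)) / n (φ j)`, and receives
the uniformly re-rooted `x (φ j)` in the density-transfer (portmanteau) form
(`exists_limit_separated` with the hard core `δ` and the nonemptiness `1 ≤ n k` as hypotheses).
[folklore] -/
theorem stub_bsLimit :
    ∀ δ : ℝ, 0 < δ → ∀ (n : ℕ → ℕ) (x : (k : ℕ) → (Fin (n k) → E3)), (∀ k, 1 ≤ n k) →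
    (∀ k (i j : Fin (n k)), i ≠ j → δ ≤ dist (x k i) (x k j)) →
    ∃ φ : ℕ → ℕ, StrictMono φ ∧ ∃ P : Measure (Measure E3), IsProbabilityMeasure P ∧
      (∀ᵐ μ ∂P, (∃ S : Set E3, (0 : E3) ∈ S ∧ (∀ p ∈ S, ∀ q ∈ S, p ≠ q → δ ≤ dist p q) ∧
        μ = (Measure.count : Measure E3).restrict S)) ∧
      (∀ g : Measure E3 → E3 → ℝ≥0∞, Measurable (Function.uncurry g) →
        ∫⁻ μ, ∫⁻ y, g μ y ∂μ ∂P = ∫⁻ μ, ∫⁻ y, g (Measure.map (fun z => z - y) μ) (-y) ∂μ ∂P) ∧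
      Tendsto (fun j : ℕ => interactionEnergy lennardJones (x (φ j)) / (n (φ j) : ℝ)) atTop
        (𝓝 (∫ μ, (∫ y, lennardJones ‖y‖ ∂μ) / 2 ∂P)) ∧
      ∀ T : Set (Measure E3), ∀ R ε : ℝ, 0 < ε → ∀ ρ : ℝ, ρ < (P T).toReal →
        ∀ᶠ j : ℕ in atTop, ρ * (n (φ j) : ℝ) ≤ (Nat.card {i : Fin (n (φ j)) // ∃ ν ∈ T,
          ((∀ p : E3, ν {p} ≠ 0 → ‖p‖ ≤ R →
              ∃ q ∈ (Set.range (fun k : Fin (n (φ j)) => x (φ j) k - x (φ j) i)), dist q p ≤ ε) ∧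
            (∀ q ∈ (Set.range (fun k : Fin (n (φ j)) => x (φ j) k - x (φ j) i)), ‖q‖ ≤ R →
              ∃ p : E3, ν {p} ≠ 0 ∧ dist q p ≤ ε))} : ℝ) := by
  intro δ hδ n x hn hsepx
  haveI : Fact (0 < δ) := ⟨hδ⟩
  haveI : ∀ k, NeZero (n k) := fun k => ⟨Nat.one_le_iff_ne_zero.1 (hn k)⟩
  exact exists_limit_separated x hsepx

end Summit.AtomisticToContinuum.Crystallization.Theorems.EkelandSurgeryParityBSLimit
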